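import Mathlib
import HarnessLib

/-!
# Haar averaging of a cone certificate

Abstract Haar averaging; Mathlib only; no named facts.

Let a compact group `G` act linearly and (strongly) continuously on a finite-dimensional real
normed space `V` through `ρ : G →* (V →L[ℝ] V)`, and let `Λ i` (`i : ι`) be a family of
continuous linear functionals whose common nonnegativity cone is `ρ`-stable.  If `τ` lies in
the cone and is strictly positive on one functional `Λ i₀`, then the Haar average
`τ' = ∫ g, ρ g τ ∂μ` is a `G`-fixed vector which again lies in the cone and is strictly positive
on `Λ i₀`.

The proof is the standard one: invariance from left invariance of `μ` and
`ContinuousLinearMap.integral_comp_comm`; nonnegativity from `integral_nonneg`; strict positivity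
because `g ↦ Λ i₀ (ρ g τ)` is a continuous nonnegative function, positive at `1`, and nonempty
open sets have positive measure.

This is the registered stub `stub_haarAverage` of the refutation skeleton of the crux
`OddMorawetzLocal`, landed under the durable name `haarAverage_fixed_of_cone`.
-/

noncomputable section

set_option linter.dupNamespace false

namespace Summit.NavierStokesRegularity.NavierStokesRegularity.Theorems

open MeasureTheory

/-- **Haar average of a certificate is a fixed certificate.**  For a compact group `G` with a
left-invariant probability measure `μ` positive on open sets, a strongly continuous linear action
`ρ : G →* (V →L[ℝ] V)` on a finite-dimensional space, and a `ρ`-stable cone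
`{τ | ∀ i, 0 ≤ Λ i τ}`: every cone element `τ` with `0 < Λ i₀ τ` yields a `G`-fixed cone element
`τ'` with `0 < Λ i₀ τ'` (namely `τ' = ∫ g, ρ g τ ∂μ`). -/
theorem haarAverage_fixed_of_cone {G : Type*} [Group G] [TopologicalSpace G]
    [IsTopologicalGroup G] [CompactSpace G] [T2Space G] [MeasurableSpace G] [BorelSpace G]
    (μ : MeasureTheory.Measure G) [MeasureTheory.IsProbabilityMeasure μ] [μ.IsMulLeftInvariant]
    [μ.IsOpenPosMeasure]
    {V : Type*} [NormedAddCommGroup V] [NormedSpace ℝ V] [FiniteDimensional ℝ V] [CompleteSpace V]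
    (ρ : G →* (V →L[ℝ] V)) (hρ : ∀ τ : V, Continuous fun g : G => ρ g τ)
    {ι : Type*} (Λ : ι → (V →L[ℝ] ℝ))
    (hcov : ∀ (g : G) (τ : V), (∀ i, 0 ≤ Λ i τ) → ∀ i, 0 ≤ Λ i (ρ g τ))
    (τ : V) (hτ : ∀ i, 0 ≤ Λ i τ) (i₀ : ι) (hpos : 0 < Λ i₀ τ) :
    ∃ τ' : V, (∀ g : G, ρ g τ' = τ') ∧ (∀ i, 0 ≤ Λ i τ') ∧ 0 < Λ i₀ τ' := by
  -- the orbit map is continuous on a compact space, hence Bochner integrable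
  have hint : Integrable (fun g : G => ρ g τ) μ :=
    (hρ τ).integrable_of_hasCompactSupport (HasCompactSupport.of_compactSpace _)
  refine ⟨∫ g, ρ g τ ∂μ, fun h => ?_, fun i => ?_, ?_⟩
  · -- invariance: `ρ h (∫ ρ g τ) = ∫ ρ (h * g) τ = ∫ ρ g τ`
    rw [← (ρ h).integral_comp_comm hint]
    have hfun : (fun g : G => ρ h (ρ g τ)) = fun g : G => (fun x : G => ρ x τ) (h * g) := by
      funext g
      simp [map_mul]
    rw [hfun, integral_mul_left_eq_self (fun x : G => ρ x τ) h]
  · -- nonnegativity: `Λ i (∫ ρ g τ) = ∫ Λ i (ρ g τ) ≥ 0`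
    rw [← (Λ i).integral_comp_comm hint]
    exact integral_nonneg fun g => hcov g τ hτ i
  · -- strict positivity: the integrand is continuous, nonnegative and positive at `1`
    rw [← (Λ i₀).integral_comp_comm hint]
    have hcont : Continuous fun g : G => Λ i₀ (ρ g τ) := (Λ i₀).continuous.comp (hρ τ)
    have hnonneg : 0 ≤ fun g : G => Λ i₀ (ρ g τ) := fun g => hcov g τ hτ i₀
    have hint' : Integrable (fun g : G => Λ i₀ (ρ g τ)) μ :=
      hcont.integrable_of_hasCompactSupport (HasCompactSupport.of_compactSpace _)
    rw [integral_pos_iff_support_of_nonneg hnonneg hint']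
    refine hcont.isOpen_support.measure_pos μ ⟨1, ?_⟩
    rw [Function.mem_support]
    have h1 : Λ i₀ (ρ 1 τ) = Λ i₀ τ := by simp [map_one]
    rw [h1]
    exact hpos.ne'

end Summit.NavierStokesRegularity.NavierStokesRegularity.Theorems

end
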